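import Summits.BirchSwinnertonDyer.Rank1Residual.X11b.BDPRouteCyclotomicExceptional
import HarnessLib

/-!
# Class X11b, route "BDP + converse-theorem engine + Kolyvagin" (p2): the ¬(ram) atom's
# Euler-system half from ONE rational certificate on a Heegner TWIST — no `p`-adic height, no
# second multiplicative prime; the (T2∗) residue (split at `p`, `p` the only multiplicative prime)
# becomes certificate-shaped (cell `b2b-bsdres`, sub-cell `multr1-p2`, gen 22)

HONEST FRAMING (cell `b2b-bsdres`, run/shared/lean/b2b/bsd-rank1-residual/, verbatim in every
file): the goal of the cell is to DELETE the COMBINATION-SHAPED residual classes of the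
Birch–Swinnerton-Dyer formula for ALL analytic-rank `≤ 1` elliptic curves over `ℚ` — "full BSD
formula for every rank `≤ 1` curve in class `C`" assembled STRICTLY from published theorems — so
that the rank-`≤ 1` remainder becomes exactly the CONSTRUCTION-SHAPED classes, which are TYPED
(missing-input `Prop`s), NOT attempted. This is not "finishing BSD". Sub-cell `multr1-p2` is a
RESEARCH ROUTE on class X11b (`ClassX11b W p := r_an = 1 ∧ p ≠ 2 ∧ mult(p) ∧ irr(p)`,
`Partition/Rows.lean`); no claim beyond the stated class and loci; X11b's label does not change;
NOTHING is booked by this file (admissibility of a per-pair closure is the referee's ruling; how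
the twist's central value is certified is lane business).

THEOREMS ONLY (no definition, no named fact, no `sorry`).

WHY. After gen 21 (`BDPRouteCyclotomicRecord.lean`, `BDPRouteCyclotomicExceptional.lean`) the
¬(ram) atom of X11b at `p ≥ 5` (112 175 ‖ 6 637 surjective pairs of the X11b shape,
`N < 5·10⁵ ‖ N < 2·10⁴`) reads: main-conjecture half ⇐ THE open input at the pair
(`P2.missingLowerBoundAt_of_openInputAt`); Euler-system half ⇐ Kato's divisibility + Jones +
Disegni 2020 Thm. 1 + ONE `p`-adic height (REG) — available at a NON-split `p` and at a split `p`
with a SECOND multiplicative prime (Disegni's hypothesis (∗)), so that the 55 089 ‖ 3 326 pairs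
"split at `p`, `p` the only multiplicative prime" (T2∗) kept NO source for the Euler-system half
(typed by name through the lane's conjecture `ClassClosure.RelativeExceptionalLeadingTermAt`).

OBSERVATION (this file). The Euler-system half on a surjective rank-one pair with `p ∤ ∏_ℓ c_ℓ(E)`
needs NO `p`-adic analysis at all: at ANY imaginary quadratic Heegner field `K` of `E` (every
`ℓ ∣ N` split; `p ∣ N` splits), Kolyvagin 1990 Thm. A gives `ord_p #Ш(E/K) ≤ 2·ord_p [E(K):ℤP_K]`,
and the Gross–Zagier bookkeeping identity of this sub-cell (`exists_shaAn_padicVal_eq_of_heegner`,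
gen 3; JSW 2017 (eq:gz for K′)) reads
`2·ord_p [E(K):ℤP_K] = ord_p #Ш(E)_an + ord_p (L(E^{d_K},1)/Ω_{E^{d_K}}) + ord_p ∏_ℓ c_ℓ(E)
 + 2·ord_p #E^{d_K}(ℚ)_tors` (Manin constant, `u(Cd)`, `#𝓞_K^×` prime to `p`). Hence, if the
twist's algebraic central value `q_d = L(E^{d_K},1)/Ω(Wd)` is a `p`-adic UNIT — ONE rational number,
computed exactly by modular symbols — then (irreducibility kills the twist's torsion)
`ord_p #Ш(E) + ord_p #Ш(E^{d_K}) ≤ ord_p #Ш(E)_an`: the Euler-system half for `E`, with NO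
regulator, NO second multiplicative prime, NO condition on the reduction SIGN at `p`, NO (ram).
(The inequality sits inside additive-p1's per-pair tools `RankOneIndexCertificate.lean` /
`RankOneShaCertificate.lean`, gens 10/12, which close a pair from `p ∤ [E(K):ℤP]` resp. a finite
`Ш`-certificate; here it is EXPOSED as the Euler-system half and COMPOSED with route p2's open
input, which supplies the other half — no Heegner-index computation, no `Ш`-element.)
CONSEQUENCES (all CONDITIONAL on the named facts and inputs in each signature; nothing booked).
§1 `exists_shaAn_padicValNat_shaOrder_add_le_of_heegner_of_twistUnit` — datum level, ANY odd `p`,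
any reduction type (class-agnostic; for the x11b3 team at `p = 3`, `p ∤ #𝓞_K^×` ⇐ `d_K < -4`).
§2 `missingUpperBoundAt_of_classX11b_of_twistUnit` — X11b ∧ `p ≥ 5` ∧ `Surj` ∧ `p ∤ ∏c`, a GIVEN
Heegner field `K` (`d_K < -4`) and minimal twist model `Wd` with unit central value: the
Euler-system half `Typed.MissingUpperBoundAt W p` from PUBLISHED facts + that ONE certificate
(Manin datum, `u(Cd)`, `w_K` discharged). §3 `P2.bsdp_and_bsdp_twist_of_openInputAt_of_twistUnit` —
+ THE open input at the pair: `BSD(E,p)` AND `BSD(E^{d_K},p)`;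
`P2.bsdp_of_split_of_openInputAt_of_twistUnit` — the (T2∗) reading: X11b ∧ `p ≥ 5` ∧ SPLIT at
`p` ∧ `p ∤ ∏c` (⇒ très ramifié ⇒ `Surj`, gen 8): `BSD(E,p)` ⇐ open input + ONE twist
certificate; no (∗), no REG, no conjecture. Records: `X11b/BDPRouteTwistCertificateRecord.lean`.
CENSUS (recount of multr1-p1 `census500k`, seat dir `census22/`): ¬(ram) ∧ surj 112 175 ‖ 6 637 =
`p ∤ ∏c` 110 083 ‖ 6 470 [reached by open input + twist certificate: non-split 54 704 ‖ 3 147,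
split with 2nd mult. prime 624 ‖ 32, split-only 54 755 ‖ 3 291] + `p ∣ ∏c` 2 092 ‖ 167 [non-split
835 / 2nd-mult 923: REG road; split-only 334 ‖ 35: conjecture]. Labels UNCHANGED; X11b stays
CONSTRUCTION-SHAPED (THE open input unrefereed; certificates are per pair).
References: [McCallumLMS1991] §1 Theorem (Kolyvagin), p. 296; [GrossLMS1991] Thm. 1.3, Prop. 2.1;
[JetchevSkinnerWan2017] §7.4.1 (eq:gz for K′), §7.3.1 (eq:tamK); [GrossZagier1986] I (6.5), V §2;
[Mazur1978] Cor. 4.1; [Castella2018] Thm. 2.3, Thm. 3.2; [Castella2018Erratum] (2.4);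
[Disegni2020] Thm. 1, (∗); [SilvermanATAEC1994] V.6 Prop. 6.1, Cor. IV.9.2; [Miller2011LMS] Def. 1.1.
-/

noncomputable section

open scoped Classical NumberField

open WeierstrassCurve NumberField IsDedekindDomain Field
open Literature.NumberTheory.EllipticCurves Literature.NumberTheory.EllipticCurves.GreenbergSelmer
  Literature.NumberTheory.EllipticCurves.ModularForms
  Literature.NumberTheory.EllipticCurves.Rank1Residual
  Literature.NumberTheory.EllipticCurves.Rank1Residual.Typed
  Literature.NumberTheory.EllipticCurves.Wuthrich2014
  Literature.NumberTheory.EllipticCurves.SteinWuthrich2013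
  Literature.NumberTheory.EllipticCurves.Disegni2020
  Literature.NumberTheory.EllipticCurves.Skinner2016
  Literature.NumberTheory.EllipticCurves.BalakrishnanEtAl2019
  Literature.NumberTheory.EllipticCurves.KrizLi2019
  Literature.NumberTheory.QuadraticFields.Quadratic
  Literature.NumberTheory.Automorphic
  Literature.NumberTheory.GaloisRepresentations Literature.NumberTheory.GaloisCohomology

namespace Summit.BirchSwinnertonDyer.Rank1Residual.X11b

/-! ### §1. Datum level, ANY odd `p`: the twist's unit central value bounds `Ш(E)` and `Ш(E^{d_K})` -/

/-- **Kolyvagin's bound read through the Gross–Zagier bookkeeping identity at a UNIT twist value —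
ANY odd prime `p`, any reduction type at `p`, `ρ̄_{E,p}` onto.** Data: `W/ℚ` globally minimal with
`ord_{s=1} L(E,s) = 1`; `K` imaginary quadratic with the Heegner hypothesis for the level `N`;
`P ∈ E(K)` the Heegner point of a parametrisation datum `Dt` with `p ∤ c(Dt)`; `p ∤ #𝓞_K^×`;
`Wd = Cd • W^{(d_K)}` a globally minimal model of the twist with `ord_p u(Cd) = 0`; `p ∤ ∏_ℓ c_ℓ(E)`.
CERTIFICATE: the twist's algebraic central value `q_d = L(E^{d_K},1)/Ω(Wd) ≠ 0` is a `p`-adic unit.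
CONCLUSION: `#Ш(E)_an = q ∈ ℚ` with `ord_p q = 2·ord_p [E(K):ℤP]` and
`ord_p #Ш(E) + ord_p #Ш(Wd) ≤ 2·ord_p [E(K):ℤP]` — in particular the Euler-system half
`ord_p #Ш(E) ≤ ord_p #Ш(E)_an`. Proof: `exists_shaAn_padicVal_eq_of_heegner` (identity and the
decomposition `ord_p #Ш(E/K) = ord_p #Ш(E) + ord_p #Ш(Wd)`), the twist's torsion is prime to `p`
(irreducibility transports to the twist), Kolyvagin 1990 Thm. A (`hB`) at the non-torsion Heegner
point (`L'(E/K,1) = L'(E,1)·L(E^{d_K},1) ≠ 0`, Gross–Zagier). PUBLISHED binders `hGZ`, `hKo`, `hB`,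
`hGZK`, `hmod`; per datum; nothing booked. (The same two lines open additive-p1's
`missingPPartAt_and_twist_of_indexValuation_of_pow_dvd`; exposed here without any index or
`Ш`-certificate.) [cite: McCallumLMS1991, §1 Theorem (Kolyvagin), p. 296]
[cite: JetchevSkinnerWan2017, §7.4.1 (eq:gz for K′), p. 30] [cite: GrossLMS1991, §2 Prop. 2.1 (2)]
[cite: Miller2011LMS, §1 and Def. 1.1] -/
theorem exists_shaAn_padicValNat_shaOrder_add_le_of_heegner_of_twistUnit
    (W : WeierstrassCurve ℚ) [W.IsElliptic] [W.IsGloballyMinimal] (p : ℕ) [Fact p.Prime]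
    (N : ℕ) [NeZero N] (K : Type) [Field K] [NumberField K]
    (Dt : ModularParametrizationData W N) (H : HeegnerDatum N (NumberField.discr K)) (ι : K →+* ℂ)
    (P : (W.baseChange K).toAffine.Point)
    -- the published inputs (named facts of the tree)
    (hGZ : gross_zagier N W K) (hKo : kolyvagin N W K)
    (hB : Kolyvagin1990_padicValNat_card_sha_le N W K)
    (hGZK : rank_eq_analyticRank_of_analyticRank_le_one) (hmod : hasEntireLFunction_rat)
    -- the pair and the Heegner data
    (hK : IsImaginaryQuadratic K) (hHN : SatisfiesHeegnerHypothesis N K)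
    (hP : WeierstrassCurve.Affine.Point.map ι.toRatAlgHom P = heegnerPointComplex Dt H)
    (hp2 : p ≠ 2) (hc : ¬ (p : ℤ) ∣ Dt.c) (hμ : ¬ p ∣ Units.torsionOrder K)
    (hr : W.analyticRank = 1) (hsurj : Surj W p)
    (Wd : WeierstrassCurve ℚ) [Wd.IsElliptic] [Wd.IsGloballyMinimal] (Cd : VariableChange ℚ)
    (hWd : Cd • W.quadraticTwist (NumberField.discr K : ℚ) = Wd)
    (hu : padicValRat p (Cd.u : ℚ) = 0)
    -- the certificate: the twist's algebraic central value is a `p`-adic unit; `p ∤ ∏c_ℓ(E)`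
    (qd : ℚ) (hqd : Wd.entireLFunction 1 / (Wd.realPeriodRat : ℂ) = (qd : ℂ)) (hqd0 : qd ≠ 0)
    (hvd : padicValRat p qd = 0) (htam : ¬ p ∣ W.tamagawaProduct) :
    ∃ q : ℚ, shaAn W = (q : ℂ) ∧
      padicValRat p q = 2 * (padicValNat p (AddSubgroup.zmultiples P).index : ℤ) ∧
      padicValNat p W.shaOrder + padicValNat p Wd.shaOrder ≤
        2 * padicValNat p (AddSubgroup.zmultiples P).index := by
  have hp : p.Prime := Fact.out
  have hirr : Irr W p := hasIrreducibleModPGaloisRep_of_hasSurjectiveModNGaloisRep W p hsurj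
  have hD0 : (NumberField.discr K : ℚ) ≠ 0 := by exact_mod_cast NumberField.discr_ne_zero K
  haveI hEt : (W.quadraticTwist (NumberField.discr K : ℚ)).IsElliptic :=
    W.isElliptic_quadraticTwist hD0
  -- the twist's central value is non-zero
  have hLt' : (W.quadraticTwist (NumberField.discr K : ℚ)).entireLFunction = Wd.entireLFunction := by
    rw [← hWd, entireLFunction_smul]
  have hLt : (W.quadraticTwist (NumberField.discr K : ℚ)).entireLFunction 1 ≠ 0 := by
    rw [hLt']
    intro h0
    apply hqd0
    have : ((qd : ℂ)) = 0 := by rw [← hqd, h0, zero_div]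
    exact_mod_cast this
  -- the twist has no rational `p`-torsion
  have hirrd : Wd.HasIrreducibleModPGaloisRep p :=
    hasIrreducibleModPGaloisRep_twist_model W p K hK.1 hirr Cd hWd
  have htors : padicValNat p Wd.torsionOrder = 0 :=
    padicValNat_torsionOrder_eq_zero_of_irreducible Wd p hirrd
  -- the identity: finiteness, the `Ш` decomposition over `K`, and the valuation of `#Ш_an`
  obtain ⟨-, hfinK, hsum, q, hq, hid⟩ :=
    exists_shaAn_padicVal_eq_of_heegner W p N K Dt H ι P hGZ hKo hGZK hmod hK hHN hP hp2 hc hμ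
      hr hLt Wd Cd hWd hu qd hqd
  rw [hvd, htors, padicValNat.eq_zero_of_not_dvd htam] at hid
  -- `ord_p #Ш_an(E) = 2 ord_p [E(K):ℤP]`
  have hvq : padicValRat p q = 2 * (padicValNat p (AddSubgroup.zmultiples P).index : ℤ) := by
    have := hid; push_cast at this ⊢; linarith
  -- the Heegner point is non-torsion; Kolyvagin's bound
  have hPH : IsHeegnerPoint N W K P := ⟨Dt, H, ι, hP⟩
  have hL0 : W.entireLFunction 1 = 0 := entireLFunction_one_eq_zero_of_analyticRank_eq_one hr
  obtain ⟨-, hderiv⟩ := leadingLCoeff_eq_deriv_of_analyticRank_eq_one hr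
  have hLK : LDerivEK W K ≠ 0 := by
    rw [lDerivEK_eq_deriv_mul W K hmod hL0]
    exact mul_ne_zero hderiv hLt
  have hnt : ¬ IsOfFinAddOrder P :=
    (lDerivEK_ne_zero_iff_not_isOfFinAddOrder W N K hGZ hK hHN hPH).mp hLK
  have hKsha : padicValNat p (W.baseChange K).shaOrder ≤
      2 * padicValNat p (AddSubgroup.zmultiples P).index := hB hK hHN hPH hnt hp hp2 hsurj
  refine ⟨q, hq, hvq, ?_⟩
  omega

/-! ### §2. Class X11b, `p ≥ 5`: the Euler-system half from ONE twist certificate at a GIVEN Heegner field -/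

section Pair

variable (W : WeierstrassCurve ℚ) [W.IsElliptic] [W.IsGloballyMinimal] (p : ℕ) [Fact p.Prime]

/-- **X11b ∧ `p ≥ 5` ∧ `ρ̄_{E,p}` onto ∧ `p ∤ ∏_ℓ c_ℓ(E)`, at a GIVEN Heegner field `K` with
`d_K < -4` and a unit twist value: `#Ш(E)_an = q ∈ ℚ` with `ord_p #Ш(E) + ord_p #Ш(Wd) ≤ ord_p q`.**
Everything datum-shaped in §1 is DISCHARGED: a parametrisation datum with `p ∤ c` (modularity
`hnf` + Mazur 1978 Cor. 4.1 `hMaz` + the Néron mapping property, a tree THEOREM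
`integral_neronScaling_of_isGloballyMinimal_holds`; `exists_maninDatum`), `ord_p u(Cd) = 0` for ANY
globally minimal model of the twist (`padicValRat_u_eq_zero_of_twist_minimal`: `p ∣ N` splits in
`K`), `#𝓞_K^× = 2` (`d_K < -4`). NO (ram), NO condition on the reduction sign at `p`, NO `p`-adic
height, NO second multiplicative prime. PUBLISHED binders: Gross–Zagier, Kolyvagin ×2 (`hKo`,
`hB`), GZK, modularity ×2 (`hmod`, `hnf`), Mazur 1978 Cor. 4.1. Per pair (the certificate
`(K, Wd, q_d)` is data); nothing booked. [cite: McCallumLMS1991, §1 Theorem (Kolyvagin), p. 296]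
[cite: JetchevSkinnerWan2017, §7.4.1 (eq:gz for K′), p. 30] [cite: Mazur1978, Cor. 4.1]
[cite: Miller2011LMS, §1 and Def. 1.1] -/
theorem exists_shaAn_padicValNat_shaOrder_add_le_of_classX11b_of_twistUnit
    (hGZ : ∀ (N : ℕ) [NeZero N] (W : WeierstrassCurve ℚ) (K : Type) [Field K] [NumberField K],
      gross_zagier N W K)
    (hKo : ∀ (N : ℕ) [NeZero N] (W : WeierstrassCurve ℚ) (K : Type) [Field K] [NumberField K],
      kolyvagin N W K)
    (hB : ∀ (N : ℕ) [NeZero N] (W : WeierstrassCurve ℚ) (K : Type) [Field K] [NumberField K],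
      Kolyvagin1990_padicValNat_card_sha_le N W K)
    (hGZK : rank_eq_analyticRank_of_analyticRank_le_one) (hmod : hasEntireLFunction_rat)
    (hnf : exists_isNewformOf) (hMaz : mazur_not_dvd_maninConstant_of_odd)
    -- the pair: X11b, `p ≥ 5`, surjective, `p ∤ ∏c`
    (hX : ClassX11b W p) (hp5 : 5 ≤ p) (hsurj : Surj W p) (htam : ¬ p ∣ W.tamagawaProduct)
    -- the certificate: a Heegner field, a minimal model of the twist, its unit central value
    (K : Type) [Field K] [NumberField K] (hK : IsImaginaryQuadratic K)
    (hHN : SatisfiesHeegnerHypothesis (W.conductorNorm ℤ) K) (hdK : NumberField.discr K < -4)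
    (Wd : WeierstrassCurve ℚ) [Wd.IsElliptic] [Wd.IsGloballyMinimal] (Cd : VariableChange ℚ)
    (hWd : Cd • W.quadraticTwist (NumberField.discr K : ℚ) = Wd)
    (qd : ℚ) (hqd : Wd.entireLFunction 1 / (Wd.realPeriodRat : ℂ) = (qd : ℂ)) (hqd0 : qd ≠ 0)
    (hvd : padicValRat p qd = 0) :
    ∃ q : ℚ, shaAn W = (q : ℂ) ∧
      (padicValNat p W.shaOrder : ℤ) + padicValNat p Wd.shaOrder ≤ padicValRat p q := by
  obtain ⟨hr, hp2, hmult, hirr⟩ := hX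
  haveI : NeZero (W.conductorNorm ℤ) := ⟨(W.conductorNorm_pos_holds).ne'⟩
  -- `w_K = 2`, prime to `p`
  have hμ : ¬ p ∣ Units.torsionOrder K := by
    rw [Literature.NumberTheory.DiophantineGeometry.torsionOrder_eq_two_of_discr_lt hK.1 hdK]
    intro h2
    have := Nat.le_of_dvd two_pos h2
    omega
  -- the Heegner datum with `p ∤ c` (modularity, Mazur 1978 Cor. 4.1, Néron mapping property)
  obtain ⟨Dt, H, ι, P, hP, hc⟩ :=
    exists_maninDatum hnf hMaz integral_neronScaling_of_isGloballyMinimal_holds W p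
      (W.conductorNorm ℤ) K rfl hp5 hmult hirr hK hHN
  -- the minimal twist model differs by a `p`-unit (`p ∣ N` splits in `K`)
  have hu : padicValRat p (Cd.u : ℚ) = 0 :=
    padicValRat_u_eq_zero_of_twist_minimal W p K hK hHN hmult Cd hWd
  obtain ⟨q, hq, hvq, hle⟩ :=
    exists_shaAn_padicValNat_shaOrder_add_le_of_heegner_of_twistUnit W p (W.conductorNorm ℤ) K Dt H
      ι P (hGZ _ W K) (hKo _ W K) (hB _ W K) hGZK hmod hK hHN hP hp2 hc hμ hr hsurj Wd Cd hWd hu qd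
      hqd hqd0 hvd htam
  refine ⟨q, hq, ?_⟩
  rw [hvq]
  exact_mod_cast hle

/-- **The Euler-system half `ord_p #Ш(E) ≤ ord_p #Ш(E)_an` on X11b ∧ `p ≥ 5` ∧ `ρ̄` onto ∧
`p ∤ ∏_ℓ c_ℓ(E)` from ONE twist certificate** (a Heegner field `K` with `d_K < -4`, a globally
minimal model `Wd` of `E^{d_K}`, `q_d = L(E^{d_K},1)/Ω(Wd) ≠ 0` with `ord_p q_d = 0`) and PUBLISHED
facts only — the typed output `Typed.MissingUpperBoundAt W p`. On the ¬(ram) atom this replaces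
BOTH gen 6's sourceless input (X11a's main-conjecture half at the twist,
`missingUpperBoundAt_of_classX11b_of_not_ram_of_lowerX11a`) and gen 21's `p`-adic height (REG,
`missingUpperBoundAt_of_katoSurj_of_regulatorNonvanishing`, which at a split `p` also needs
Disegni's second multiplicative prime). Per pair; nothing booked.
[cite: McCallumLMS1991, §1 Theorem (Kolyvagin), p. 296] [cite: JetchevSkinnerWan2017, §7.4.1 (p. 30)]
[cite: Miller2011LMS, Def. 1.1] -/
theorem missingUpperBoundAt_of_classX11b_of_twistUnit
    (hGZ : ∀ (N : ℕ) [NeZero N] (W : WeierstrassCurve ℚ) (K : Type) [Field K] [NumberField K],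
      gross_zagier N W K)
    (hKo : ∀ (N : ℕ) [NeZero N] (W : WeierstrassCurve ℚ) (K : Type) [Field K] [NumberField K],
      kolyvagin N W K)
    (hB : ∀ (N : ℕ) [NeZero N] (W : WeierstrassCurve ℚ) (K : Type) [Field K] [NumberField K],
      Kolyvagin1990_padicValNat_card_sha_le N W K)
    (hGZK : rank_eq_analyticRank_of_analyticRank_le_one) (hmod : hasEntireLFunction_rat)
    (hnf : exists_isNewformOf) (hMaz : mazur_not_dvd_maninConstant_of_odd)
    (hX : ClassX11b W p) (hp5 : 5 ≤ p) (hsurj : Surj W p) (htam : ¬ p ∣ W.tamagawaProduct)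
    (K : Type) [Field K] [NumberField K] (hK : IsImaginaryQuadratic K)
    (hHN : SatisfiesHeegnerHypothesis (W.conductorNorm ℤ) K) (hdK : NumberField.discr K < -4)
    (Wd : WeierstrassCurve ℚ) [Wd.IsElliptic] [Wd.IsGloballyMinimal] (Cd : VariableChange ℚ)
    (hWd : Cd • W.quadraticTwist (NumberField.discr K : ℚ) = Wd)
    (qd : ℚ) (hqd : Wd.entireLFunction 1 / (Wd.realPeriodRat : ℂ) = (qd : ℂ)) (hqd0 : qd ≠ 0)
    (hvd : padicValRat p qd = 0) :
    Typed.MissingUpperBoundAt W p := by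
  obtain ⟨q, hq, hle⟩ := exists_shaAn_padicValNat_shaOrder_add_le_of_classX11b_of_twistUnit W p
    hGZ hKo hB hGZK hmod hnf hMaz hX hp5 hsurj htam K hK hHN hdK Wd Cd hWd qd hqd hqd0 hvd
  refine ⟨q, hq, ?_⟩
  have h0 : (0 : ℤ) ≤ padicValNat p Wd.shaOrder := by exact_mod_cast Nat.zero_le _
  linarith

/-! ### §3. With THE open input at the pair: `BSD(E,p)` and `BSD(E^{d_K},p)`; the (T2∗) reading -/

/-- **X11b ∧ `p ≥ 5` ∧ `ρ̄` onto ∧ `p ∤ ∏_ℓ c_ℓ(E)`: THE open input at the pair + ONE twist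
certificate ⟹ `BSD(E,p)` AND `BSD(E^{d_K},p)`.** The main-conjecture half `ord_p #Ш(E)_an ≤
ord_p #Ш(E)` is `P2.missingLowerBoundAt_of_openInputAt` (THE open input `P2OpenInputOnTreeAt W p` =
(IMC≥∘BDP)ᵗ at the odd Manin-good Heegner data of the pair [UNREFEREED at `p ∥ N`: erratum (2.4) ⇐
FW21 Thm. 4.41], with the discharged control and Selmer inputs, gens 13–17); §2 gives
`ord_p #Ш(E) + ord_p #Ш(Wd) ≤ ord_p #Ш(E)_an`; so `ord_p #Ш(E) = ord_p #Ш(E)_an` and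
`ord_p #Ш(Wd) = 0`, and the rank-zero print shape closes the twist (`p ∤ ∏c(Wd)` by the Tamagawa
transport at a Heegner field, `p ≥ 5`; no rational `p`-torsion by irreducibility). NO regulator,
NO (ram), NO second multiplicative prime, NO sign condition at `p`. PUBLISHED binders: route p2's
(Gross–Zagier, Kolyvagin ×2, Wuthrich 2014 Prop. 21, GZK, modularity ×2, Hoffstein–Luo, Mazur 1978
Cor. 4.1, Poitou–Tate, local Euler characteristic). CONDITIONAL on the open input; per pair;
nothing booked. [cite: McCallumLMS1991, §1 Theorem (Kolyvagin), p. 296]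
[cite: JetchevSkinnerWan2017, §7.4.1 (pp. 30–31)] [cite: Castella2018, Thm. 2.3 (p. 5), Thm. 3.2 (p. 9)]
[cite: Castella2018Erratum, (2.4) (p. 1)] [cite: Wuthrich2014, Prop. 21 (p. 400)]
[cite: Miller2011LMS, Def. 1.1] -/
theorem P2.bsdp_and_bsdp_twist_of_openInputAt_of_twistUnit
    (hGZ : ∀ (N : ℕ) [NeZero N] (W : WeierstrassCurve ℚ) (K : Type) [Field K] [NumberField K],
      gross_zagier N W K)
    (hKo : ∀ (N : ℕ) [NeZero N] (W : WeierstrassCurve ℚ) (K : Type) [Field K] [NumberField K],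
      kolyvagin N W K)
    (hB : ∀ (N : ℕ) [NeZero N] (W : WeierstrassCurve ℚ) (K : Type) [Field K] [NumberField K],
      Kolyvagin1990_padicValNat_card_sha_le N W K)
    (hWu : sha_dvd_analyticSha)
    (hGZK : rank_eq_analyticRank_of_analyticRank_le_one) (hmod : hasEntireLFunction_rat)
    (hnf : exists_isNewformOf) (hHL : HoffsteinLuo1997_exists_twist_L_one_ne_zero)
    (hMaz : mazur_not_dvd_maninConstant_of_odd)
    (hPT : ∀ (K : Type) [Field K] [NumberField K], poitouTate_sum_localTatePairing_eq_zero K)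
    (hEP : ∀ (K : Type) [Field K] [NumberField K] (v : HeightOneSpectrum (𝓞 K)),
      localEulerPoincareCharacteristic (v.adicCompletion K))
    -- THE open input, at this pair
    (hA : P2OpenInputOnTreeAt W p)
    -- the pair
    (hX : ClassX11b W p) (hp5 : 5 ≤ p) (hsurj : Surj W p) (htam : ¬ p ∣ W.tamagawaProduct)
    -- the certificate
    (K : Type) [Field K] [NumberField K] (hK : IsImaginaryQuadratic K)
    (hHN : SatisfiesHeegnerHypothesis (W.conductorNorm ℤ) K) (hdK : NumberField.discr K < -4)
    (Wd : WeierstrassCurve ℚ) [Wd.IsElliptic] [Wd.IsGloballyMinimal] (Cd : VariableChange ℚ)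
    (hWd : Cd • W.quadraticTwist (NumberField.discr K : ℚ) = Wd)
    (qd : ℚ) (hqd : Wd.entireLFunction 1 / (Wd.realPeriodRat : ℂ) = (qd : ℂ)) (hqd0 : qd ≠ 0)
    (hvd : padicValRat p qd = 0) :
    BSDp W p ∧ BSDp Wd p := by
  -- the two halves for `E`
  obtain ⟨q', hq', hge⟩ :=
    P2.missingLowerBoundAt_of_openInputAt W p hGZ hKo hWu hGZK hmod hnf hHL hMaz hPT hEP hA hX hp5 hsurj
  obtain ⟨q, hq, hle⟩ := exists_shaAn_padicValNat_shaOrder_add_le_of_classX11b_of_twistUnit W p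
    hGZ hKo hB hGZK hmod hnf hMaz hX hp5 hsurj htam K hK hHN hdK Wd Cd hWd qd hqd hqd0 hvd
  have hqq : q' = q := by exact_mod_cast hq'.symm.trans hq
  subst hqq
  have h0 : (0 : ℤ) ≤ padicValNat p Wd.shaOrder := by exact_mod_cast Nat.zero_le _
  have hE : padicValRat p q' = padicValNat p W.shaOrder := by linarith
  have hshad : padicValNat p Wd.shaOrder = 0 := by
    have : (padicValNat p Wd.shaOrder : ℤ) ≤ 0 := by linarith
    omega
  refine ⟨Typed.bsdp_of_missingPPartAt W p hGZK (by rw [hX.1]) ⟨q', hq', hE⟩, ?_⟩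
  ---------------------------------------------------------------- the twist (rank zero)
  obtain ⟨hr, hp2, hmult, hirr⟩ := hX
  have hD0 : (NumberField.discr K : ℚ) ≠ 0 := by exact_mod_cast NumberField.discr_ne_zero K
  haveI hEt : (W.quadraticTwist (NumberField.discr K : ℚ)).IsElliptic :=
    W.isElliptic_quadraticTwist hD0
  have hLt' : (W.quadraticTwist (NumberField.discr K : ℚ)).entireLFunction = Wd.entireLFunction := by
    rw [← hWd, entireLFunction_smul]
  have hLd1 : Wd.entireLFunction 1 ≠ 0 := by
    intro h0'
    apply hqd0
    have : ((qd : ℂ)) = 0 := by rw [← hqd, h0', zero_div]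
    exact_mod_cast this
  have hrd : Wd.analyticRank = 0 := (Wd.analyticRank_eq_zero_iff_holds (hmod Wd)).2 hLd1
  have hirrd : Wd.HasIrreducibleModPGaloisRep p :=
    hasIrreducibleModPGaloisRep_twist_model W p K hK.1 hirr Cd hWd
  have htors : padicValNat p Wd.torsionOrder = 0 :=
    padicValNat_torsionOrder_eq_zero_of_irreducible Wd p hirrd
  have htamd : padicValNat p Wd.tamagawaProduct = 0 := by
    rw [padicValNat_tamagawaProduct_twist_of_heegner W p hp5 K hK hHN Cd hWd]
    exact padicValNat.eq_zero_of_not_dvd htam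
  refine bsdp_of_pPartRankZero Wd p hmod hGZK hrd ⟨qd, hqd, ?_⟩
  rw [hvd, hshad, htamd, htors]
  simp

/-- **The (T2∗) reading — X11b ∧ `p ≥ 5` ∧ SPLIT multiplicative at `p` ∧ `p ∤ ∏_ℓ c_ℓ(E)`:
`BSD(E,p)` (and `BSD(E^{d_K},p)`) from THE open input at the pair and ONE twist certificate — NO
second multiplicative prime, NO `p`-adic height, NO conjecture.** At a split multiplicative `p`,
`c_p = ord_p Δ_min`, so `p ∤ ∏c` forces `p ∤ ord_p Δ_min` (très ramifié) and `ρ̄_{E,p}` is onto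
by the kernel theorem `ClassX11b.surj_of_not_dvd` (gen 8; Silverman ATAEC V.6.1 + Serre Prop. 15):
the surjectivity hypothesis of `P2.bsdp_and_bsdp_twist_of_openInputAt_of_twistUnit` is DISCHARGED.
This covers 54 755 ‖ 3 291 of the 55 089 ‖ 3 326 class-wide (T2∗) pairs (split at `p`, `p` the only
multiplicative prime — where Disegni's (∗) fails and gen 21 had NO road to the Euler-system half),
all of them ¬(ram) and non-semistable; the 334 ‖ 35 with `p ∣ ord_p Δ_min` remain on the typed
conjecture. CONDITIONAL on the open input; per pair; nothing booked.
[cite: SilvermanATAEC1994, V.6 Prop. 6.1 (p. 410) and Cor. IV.9.2 (d)] [cite: Disegni2020, Thm. 1 (§1.2), (∗)]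
[cite: McCallumLMS1991, §1 Theorem (Kolyvagin), p. 296] [cite: Castella2018Erratum, (2.4) (p. 1)]
[cite: Miller2011LMS, Def. 1.1] -/
theorem P2.bsdp_of_split_of_openInputAt_of_twistUnit
    (hGZ : ∀ (N : ℕ) [NeZero N] (W : WeierstrassCurve ℚ) (K : Type) [Field K] [NumberField K],
      gross_zagier N W K)
    (hKo : ∀ (N : ℕ) [NeZero N] (W : WeierstrassCurve ℚ) (K : Type) [Field K] [NumberField K],
      kolyvagin N W K)
    (hB : ∀ (N : ℕ) [NeZero N] (W : WeierstrassCurve ℚ) (K : Type) [Field K] [NumberField K],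
      Kolyvagin1990_padicValNat_card_sha_le N W K)
    (hWu : sha_dvd_analyticSha)
    (hGZK : rank_eq_analyticRank_of_analyticRank_le_one) (hmod : hasEntireLFunction_rat)
    (hnf : exists_isNewformOf) (hHL : HoffsteinLuo1997_exists_twist_L_one_ne_zero)
    (hMaz : mazur_not_dvd_maninConstant_of_odd)
    (hPT : ∀ (K : Type) [Field K] [NumberField K], poitouTate_sum_localTatePairing_eq_zero K)
    (hEP : ∀ (K : Type) [Field K] [NumberField K] (v : HeightOneSpectrum (𝓞 K)),
      localEulerPoincareCharacteristic (v.adicCompletion K))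
    (hA : P2OpenInputOnTreeAt W p)
    (hX : ClassX11b W p) (hp5 : 5 ≤ p) (hsplit : W.HasSplitMultiplicativeReductionAtPrime p)
    (htam : ¬ p ∣ W.tamagawaProduct)
    (K : Type) [Field K] [NumberField K] (hK : IsImaginaryQuadratic K)
    (hHN : SatisfiesHeegnerHypothesis (W.conductorNorm ℤ) K) (hdK : NumberField.discr K < -4)
    (Wd : WeierstrassCurve ℚ) [Wd.IsElliptic] [Wd.IsGloballyMinimal] (Cd : VariableChange ℚ)
    (hWd : Cd • W.quadraticTwist (NumberField.discr K : ℚ) = Wd)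
    (qd : ℚ) (hqd : Wd.entireLFunction 1 / (Wd.realPeriodRat : ℂ) = (qd : ℂ)) (hqd0 : qd ≠ 0)
    (hvd : padicValRat p qd = 0) :
    BSDp W p ∧ BSDp Wd p := by
  -- split at `p` and `p ∤ ∏c` ⇒ très ramifié ⇒ `ρ̄_{E,p}` onto
  have hsurj : Surj W p :=
    ClassX11b.surj_of_not_dvd W p hX (fun hΔ ↦ htam (dvd_tamagawaProduct_of_split_of_dvd W hsplit hΔ))
  exact P2.bsdp_and_bsdp_twist_of_openInputAt_of_twistUnit W p hGZ hKo hB hWu hGZK hmod hnf hHL hMaz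
    hPT hEP hA hX hp5 hsurj htam K hK hHN hdK Wd Cd hWd qd hqd hqd0 hvd

end Pair

end Summit.BirchSwinnertonDyer.Rank1Residual.X11b

end
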